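import Summits.ResolutionOfSingularities.ResolutionOfSingularities.Theorems.PurelyInseparableDim4ResConeGoodOrPermanent
import Summits.ResolutionOfSingularities.ResolutionOfSingularities.Theorems.PurelyInseparableDim4ResConeHeavyPermanentSet
import HarnessLib
import HarnessLib.Audit.Tags

/-!
# Purely inseparable four-folds — GOOD MODULO A FROZEN LIGHT SET: the ONE residue of slice C(p, d), every prime `p`, every shade
# `d < p` (K2(p) lane, SLICE C structure theorem; file-holder res-dim4-p-5 g5)

[OURS · counted 0 · cell `res-dim4-pi` · K2(p) lane, slice C (general-`p` programme) · seat p-5 g5.]  Nothing here proves K2(p) for any `p`,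
`NoIsolatedTrap p p` or resolution of singularities in dimension ≥ 4 / characteristic `p` — NOT proved; a STRUCTURE theorem about OUR
frame's tails.  AI kernel work, weaker than expert review.

Put together: `good_or_permanentStar` (eventually GOOD, or a permanent set `P` of ≤ 2 letters with every other non-newborn boundary letter
a LEAF of the newborn), `no_tail_of_permanent_weight_ge` (a permanent set of frozen weight `≥ p − d` is impossible), and the observation
that the STAR makes the ACTIVE letters (those outside `P`) GOOD after the next satellite step: two leaves cannot both be kept
(`not_kept_both_of_tt`) once there is at most one, and right after a satellite step there is at most one (a kept leaf next to the kept
old newborn is excluded by the same lemma) — and the newborn/leaf pair is TT by the star.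
* **`good_modulo_frozen (p) (hdp : d < p)`** — on a witnessed isolated above-floor `Step0 p` chain with `x^{r₀} ∣ F₀`, constant shade
  `d < p` and `e_G ≡ 2` from `k₀`: from some `M ≥ k₀` on there is a set `P` of AT MOST TWO letters, PERMANENT (weight `≥ 1`, never
  charted, never translated) with FROZEN LIGHT total weight `d + Σ_{z ∈ P} r_M z < p`, such that at every `m ≥ M` the boundary letters
  OUTSIDE `P` are at most two and pairwise TT.  (`P = ∅` is GOOD; `P ≠ ∅` is «the two-letter game times a frozen light monomial».)
* **`no_binaryCone_tail_of_frozenGame (p) (hdp) (hgame)`** — the ONE-BINDER SOCKET: slice C(p, d) follows from killing that single class.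
[cite: CossartJannsenSaito2020, Thm. 3.10(4), Thm. 3.14, Thm. 9.3, Lemma 13.2] [cite: HauserPerlega2019PRIMS, §2 (transform D′ of D)]
bears_on: LADDER-RESOLUTION:D157-DOOR2 (res-dim4-pi · K2(p) = `RidgeBudget.NoAboveFloorTrap p p` · slice C(p, d) = ONE residue).
Supports stmt-ResolutionOfSingularities-16155 (helper).
-/

set_option linter.dupNamespace false -- mandated namespace of this single-conjunct summit

noncomputable section

namespace Summit.ResolutionOfSingularities.ResolutionOfSingularities.Theorems.PIDim4

namespace ResCone

open MvPolynomial Finset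
open Literature.AlgebraicGeometry.Resolution
open Literature.AlgebraicGeometry.Resolution.CentreBlowup
open Literature.AlgebraicGeometry.Resolution.Hauser2010
open Literature.AlgebraicGeometry.Resolution.HauserPerlega2019

variable {K : Type} [Field K] [DecidableEq K] (p : ℕ) [Fact p.Prime] [CharP K p]

/-- **GOOD MODULO A FROZEN LIGHT SET** (every prime `p`, every shade `d < p`, `e_G ≡ 2`): on a witnessed isolated above-floor `Step0 p`
chain with `x^{r₀} ∣ F₀`, constant shade `d` and `e_G ≡ 2` from `k₀`, from some `M ≥ k₀` on there is a set `P` of at most two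
PERMANENT letters (weight `≥ 1`, never charted, never translated at any `m ≥ M`) of FROZEN LIGHT total weight (`d + Σ_{z ∈ P} r_M z < p`)
outside which every state has at most two boundary letters, pairwise TT. [OURS]
[cite: CossartJannsenSaito2020, Thm. 3.10(4), Thm. 3.14, Thm. 9.3, Lemma 13.2] -/
theorem good_modulo_frozen {c : ℕ → State K} {j : ℕ → Fin 4} {b : ℕ → Fin 4 → K}
    (hc : ∀ k, IsIsolated p (c k).F ∧ Step0 p (c k) (c (k + 1))) (hw : FreeTail.IsWitnessedChain p c j b)
    (hr0 : ∀ e ∈ (c 0).F.support, (c 0).r ≤ e) (hfloor : ∀ k, ordZero (c k).F ≠ p) {k₀ d : ℕ} (hdp : d < p)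
    (hshade : ∀ k, k₀ ≤ k → (c k).shade = (d : ℕ∞)) (he : ∀ k, k₀ ≤ k → Module.finrank K (resVertex (c k)) = 2) :
    ∃ M, k₀ ≤ M ∧ ∃ P : Finset (Fin 4), P.card ≤ 2 ∧ d + ∑ z ∈ P, (c M).r z < p ∧
      (∀ z ∈ P, ∀ m, M ≤ m → 1 ≤ (c m).r z ∧ z ≠ j m ∧ b m z = 0) ∧
      (∀ m, M ≤ m → ((∃ x y : Fin 4, ∀ i, i ∉ P → i ≠ x → i ≠ y → (c m).r i = 0) ∧
          (∀ x y : Fin 4, x ∉ P → y ∉ P → x ≠ y → 1 ≤ (c m).r x → 1 ≤ (c m).r y →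
            ∀ v ∈ resVertex (c m), v x = 0 → v y = 0 → v = 0))) := by
  classical
  rcases good_or_permanentStar p hc hw hr0 hfloor hshade he with ⟨M, hM, hG⟩ | ⟨M, hM, P, -, hcard, hperm, hleaf⟩
  · refine ⟨M, hM, ∅, by simp, by simpa using hdp, by simp, fun m hm => ?_⟩
    obtain ⟨⟨x, y, hxy⟩, hTT⟩ := hG m hm
    exact ⟨⟨x, y, fun i _ => hxy i⟩, fun x y _ _ => hTT x y⟩
  -- the frozen weight is light (a heavy permanent set is impossible)
  have hlight : d + ∑ z ∈ P, (c M).r z < p := by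
    by_contra hW
    exact no_tail_of_permanent_weight_ge p hc hw hr0 hfloor hshade hM (P := P)
      (fun z hz m hm => ((hperm z hz m hm).2)) (by omega)
  have hlaw := fun m i (hi : i ≠ j m) => succ_r_apply_of_ne' p hc hw hfloor m hi
  have hhit : ∀ m i, i ≠ j m → 1 ≤ (c (m + 1)).r i → b m i = 0 ∧ 1 ≤ (c m).r i := by
    intro m i hi h1
    rw [hlaw m i hi] at h1
    by_cases hb : b m i = 0
    · rw [if_pos hb] at h1; exact ⟨hb, h1⟩
    · rw [if_neg hb] at h1; exact absurd h1 (by omega)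
  -- after the next satellite step: AT MOST ONE active boundary letter besides the newborn, for ever
  obtain ⟨k, hk, hsat⟩ := exists_satellite_ge p hc hw M
  have hone : ∀ n, ∀ y₁ y₂, y₁ ∉ P → y₂ ∉ P → y₁ ≠ j (k + 1 + n) → y₂ ≠ j (k + 1 + n) →
      1 ≤ (c (k + 1 + n + 1)).r y₁ → 1 ≤ (c (k + 1 + n + 1)).r y₂ → y₁ = y₂ := by
    intro n
    induction n with
    | zero =>
      intro y₁ y₂ hy₁P hy₂P hy₁j hy₂j hy₁ hy₂
      simp only [add_zero] at hy₁j hy₂j hy₁ hy₂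
      -- both were kept at the satellite step `k + 1`, next to the kept old newborn `j k`: each is `j k` itself
      have hjk : ∀ y, y ∉ P → y ≠ j (k + 1) → 1 ≤ (c (k + 1 + 1)).r y → y = j k := by
        intro y hyP hyj hy
        obtain ⟨hby, hy1⟩ := hhit (k + 1) y hyj hy
        by_contra hyk
        exact not_kept_both_of_tt p hc hw hr0 hfloor hshade (show k₀ ≤ k + 1 by omega)
          (hleaf k hk y hyP hyk hy1) hsat.1.symm hsat.2 hyj hby
      rw [hjk y₁ hy₁P hy₁j hy₁, hjk y₂ hy₂P hy₂j hy₂]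
    | succ n ih =>
      intro y₁ y₂ hy₁P hy₂P hy₁j hy₂j hy₁ hy₂
      rw [show k + 1 + (n + 1) = k + 1 + n + 1 by ring] at hy₁j hy₂j hy₁ hy₂
      obtain ⟨hby₁, hy₁1⟩ := hhit _ y₁ hy₁j hy₁
      obtain ⟨hby₂, hy₂1⟩ := hhit _ y₂ hy₂j hy₂
      by_contra hne
      -- at time `k + 1 + n + 1` both are boundary letters outside `P`; one of them is not the newborn `j (k + 1 + n)`
      have hmk : M ≤ k + 1 + n := by omega
      have hkk : k₀ ≤ k + 1 + n + 1 := by omega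
      by_cases h₁ : y₁ = j (k + 1 + n)
      · have h₂ : y₂ ≠ j (k + 1 + n) := fun h => hne (h₁.trans h.symm)
        exact not_kept_both_of_tt p hc hw hr0 hfloor hshade hkk (hleaf _ hmk y₂ hy₂P h₂ hy₂1)
          (h₁ ▸ hy₁j) (h₁ ▸ hby₁) hy₂j hby₂
      · by_cases h₂ : y₂ = j (k + 1 + n)
        · exact not_kept_both_of_tt p hc hw hr0 hfloor hshade hkk (hleaf _ hmk y₁ hy₁P h₁ hy₁1)
            (h₂ ▸ hy₂j) (h₂ ▸ hby₂) hy₁j hby₁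
        · exact hne (ih y₁ y₂ hy₁P hy₂P h₁ h₂ hy₁1 hy₂1)
  refine ⟨k + 2, by omega, P, hcard, ?_, fun z hz m hm => hperm z hz m (by omega), fun m hm => ?_⟩
  · -- frozen weights: the sum at `k + 2` equals the sum at `M`
    have hfro : ∀ z ∈ P, (c (k + 2)).r z = (c M).r z := by
      intro z hz
      have : ∀ t, (c (M + t)).r z = (c M).r z := by
        intro t
        induction t with
        | zero => rfl
        | succ t ih =>
          rw [show M + (t + 1) = M + t + 1 by ring, hlaw (M + t) z (hperm z hz _ (by omega)).2.1,
            if_pos (hperm z hz _ (by omega)).2.2, ih]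
      have h := this (k + 2 - M)
      rwa [show M + (k + 2 - M) = k + 2 by omega] at h
    rwa [Finset.sum_congr rfl hfro]
  · obtain ⟨n, rfl⟩ : ∃ n, m = k + 1 + n + 1 := ⟨m - k - 2, by omega⟩
    have hone' := hone n
    refine ⟨⟨j (k + 1 + n), ?_, fun i hiP hij hiy => ?_⟩, fun x y hxP hyP hxy hx hy => ?_⟩
    · -- the second active letter: any active boundary letter other than the newborn (or the newborn itself if none)
      exact if h : ∃ y, y ∉ P ∧ y ≠ j (k + 1 + n) ∧ 1 ≤ (c (k + 1 + n + 1)).r y then h.choose else j (k + 1 + n)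
    · split_ifs at hiy with h
      · obtain ⟨hyP, hyj, hy⟩ := h.choose_spec
        by_contra hi0
        exact hiy (hone' i _ hiP hyP hij hyj (by omega) hy)
      · by_contra hi0
        exact h ⟨i, hiP, hij, by omega⟩
    · -- one of `x`, `y` is the newborn, the other a leaf
      by_cases hxj : x = j (k + 1 + n)
      · subst hxj
        exact hleaf _ (by omega) y hyP (Ne.symm hxy) hy
      · by_cases hyj : y = j (k + 1 + n)
        · subst hyj
          intro v hv hvx hvy
          exact hleaf _ (by omega) x hxP hxj hx v hv hvy hvx
        · exact absurd (hone' x y hxP hyP hxj hyj hx hy) hxy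

/-- **THE ONE-BINDER SOCKET OF SLICE C(p, d)** (every prime `p`, every shade `d < p`): GIVEN (hgame) that no witnessed isolated
above-floor `Step0 p` chain with `x^{r₀} ∣ F₀`, constant shade `d` and `e_G ≡ 2` from `M` carries a set `P` of at most two permanent
letters of frozen light weight outside which every state from `M` on has at most two boundary letters, pairwise TT («the two-letter game
times a frozen light monomial»), THEN no such chain has constant shade `d` and `e_G ≡ 2` from any `k₀`. [OURS · conditional on `hgame`]
[cite: CossartJannsenSaito2020, Thm. 3.10(4), Thm. 3.14, Thm. 9.3, Lemma 13.2] -/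
theorem no_binaryCone_tail_of_frozenGame {d : ℕ} (hdp : d < p)
    (hgame : ∀ (c : ℕ → State K) (j : ℕ → Fin 4) (b : ℕ → Fin 4 → K) (M : ℕ) (P : Finset (Fin 4)),
      (∀ k, IsIsolated p (c k).F ∧ Step0 p (c k) (c (k + 1))) → FreeTail.IsWitnessedChain p c j b →
      (∀ e ∈ (c 0).F.support, (c 0).r ≤ e) → (∀ k, ordZero (c k).F ≠ p) →
      (∀ k, M ≤ k → (c k).shade = (d : ℕ∞)) → (∀ k, M ≤ k → Module.finrank K (resVertex (c k)) = 2) →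
      P.card ≤ 2 → d + ∑ z ∈ P, (c M).r z < p → (∀ z ∈ P, ∀ m, M ≤ m → 1 ≤ (c m).r z ∧ z ≠ j m ∧ b m z = 0) →
      (∀ m, M ≤ m → ((∃ x y : Fin 4, ∀ i, i ∉ P → i ≠ x → i ≠ y → (c m).r i = 0) ∧
          (∀ x y : Fin 4, x ∉ P → y ∉ P → x ≠ y → 1 ≤ (c m).r x → 1 ≤ (c m).r y →
            ∀ v ∈ resVertex (c m), v x = 0 → v y = 0 → v = 0))) → False)
    {c : ℕ → State K} {j : ℕ → Fin 4} {b : ℕ → Fin 4 → K}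
    (hc : ∀ k, IsIsolated p (c k).F ∧ Step0 p (c k) (c (k + 1))) (hw : FreeTail.IsWitnessedChain p c j b)
    (hr0 : ∀ e ∈ (c 0).F.support, (c 0).r ≤ e) (hfloor : ∀ k, ordZero (c k).F ≠ p) {k₀ : ℕ}
    (hshade : ∀ k, k₀ ≤ k → (c k).shade = (d : ℕ∞)) (he : ∀ k, k₀ ≤ k → Module.finrank K (resVertex (c k)) = 2) : False := by
  obtain ⟨M, hM, P, hcard, hlight, hperm, hgood⟩ := good_modulo_frozen p hc hw hr0 hfloor hdp hshade he
  exact hgame c j b M P hc hw hr0 hfloor (fun k hk => hshade k (by omega)) (fun k hk => he k (by omega)) hcard hlight hperm hgood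

end ResCone

end Summit.ResolutionOfSingularities.ResolutionOfSingularities.Theorems.PIDim4

end
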